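import Summits.BirchSwinnertonDyer.Rank1Residual.Additive.LocalPointsFixedDivisible
import Summits.BirchSwinnertonDyer.Rank1Residual.Additive.UnramifiedKummerDoorGeneric
import Summits.BirchSwinnertonDyer.Rank1Residual.Additive.UnramifiedClassesLocal
import Summits.BirchSwinnertonDyer.Rank1Residual.Additive.InertialTorsionAdditive
import Summits.BirchSwinnertonDyer.Rank1Residual.X11b.KummerLocalTorsionSaturation
import HarnessLib

/-!
# The exact door at `v ∤ p`: a class of `H¹(K_v, E[p^k])` dying in `H¹(H, E(K̄_v))` for some
# `H ⊇ I_v` lies in `H¹_ur(K_v, E[p^k]) ⊔ 𝓚_v`, when `E(K_v^nr)[p^∞]` is killed by `p^k`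
# (cell `b2b-bsdres`, team n1011, seat p06 GEN 5; OWNERS row T-E3g-DOOR, FILE B2)

HONEST FRAMING (cell `b2b-bsdres`, run/shared/lean/b2b/bsd-rank1-residual/, verbatim in every
file): the goal of the cell is to DELETE the COMBINATION-SHAPED residual classes of the
Birch–Swinnerton-Dyer formula for ALL analytic-rank `≤ 1` elliptic curves over `ℚ` — "full BSD
formula for every rank `≤ 1` curve in class `C`" assembled STRICTLY from published theorems — so
that the rank-`≤ 1` remainder becomes exactly the CONSTRUCTION-SHAPED classes, which are TYPED
(missing-input `Prop`s), NOT attempted. This is not "finishing BSD". Team n1011 (N10/N11: X4 ∧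
`p = 3`): research routes on CONSTRUCTION-SHAPED classes; census output = EVIDENCE / conjecture
items, never a Literature fact; RESIDUAL-MAP marks UNCHANGED; nothing is booked by this file.
THEOREMS ONLY: no definition, no named fact, nothing asserted; a SIZING statement (which local
classes CAN enter the Route-G budget), not a yield claim.

## What and why (row T-E3g-DOOR = r2 ROUTE-2 II.18.4 / ST-18.2 STEP 1, LOCAL half)

p10's T-E3g-BUD0 FILE 3b (`Additive/UnramifiedClassesLocal.lean`) proves: a local class
`c ∈ H¹_ur(K_v, E[p]) ⊔ 𝓚_v` at `v ∤ p` dies in `H¹(Gal(K̄_v/K_{∞,η}), E(K̄_v))`, i.e. satisfies the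
local condition of `Sel_{p^∞}(E/K_∞)` at `v` (`resH1Hom_localSubgroup_map_eq_zero_of_mem_unramified_sup_kummer`).
THIS FILE proves the CONVERSE under the theorem-shaped binder `hI` of row T-E3g-ADD ("every
`I_v`-fixed point of `E[p^∞]` is killed by `p^k`"; TRUE at every additive `v ∤ p` for odd `p`,
`inertia_torsion_of_hasAdditiveReductionAt`), and for ANY subgroup `H ≤ Γ_{K_v}` containing
`I_v = absInertia K_v` in place of `Gal(K̄_v/K_{∞,η})` — so it serves the level `0`, every layer
`K_n` (over `W.baseChange (κ.layer n)`), and every `ℤ_p`-extension at once: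

* §1 is FILE B1 (`Additive/UnramifiedKummerDoorGeneric.lean`, generic `i : A ↪ B`:
  `mem_unramifiedSubgroup_sup_ker_map_of_principal_on_absInertia`, `H¹(i)⁻¹(H¹_ur) = H¹_ur ⊔ ker H¹(i)`).
* §2 (`E/K`, `v ∤ p`): `mem_unramifiedSubgroup_sup_kummerLocalConditionAt_pow_of_resH1Hom_eq_zero`
  — a class `c ∈ H¹(K_v, E[p^k])` whose image in `H¹(H, E(K̄_v))` vanishes (`H ⊇ I_v`) lies in
  `H¹_ur ⊔ 𝓚_v`, granted `hI`.  The coefficient change `E(K̄_v) ⇝ E[p^∞]` on `H` is FILE A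
  (`exists_fixed_sub_pow_nsmul_mem_primaryComponent`: `E(K̄_v)^H` is `p`-divisible modulo
  `p`-power torsion — Greenberg Prop. 2.1); then §1 with `i = E[p^k] ↪ E[p^∞]` and
  `ker H¹(i) = 𝓚_v` at `v ∤ p` (X11b `LevelKummer.kummerLocalConditionAt_eq_ker_map_primaryInclusion`).
* §3: for a `ℤ_p`-extension `κ`, `I_v ≤ Gal(K̄_v/K_{∞,η})` (`absInertia_le_localSubgroup_kerSubgroup`,
  the tree's `apply_eq_one_of_mem_absInertia`), and THE DOOR as an `iff` with p10's direction:
  `resH1Hom_localSubgroup_map_eq_zero_iff_mem_unramified_sup_kummer`.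
* §4: the binder-free forms at an ADDITIVE `v ∤ p`, `p` odd (`hI` discharged by T-E3g-ADD FILE B).

Consequence (row T-E3g-ADD + this file): at an additive `v ∤ p` the door of the Route-G budget is
EXACTLY `H¹_ur ⊕ 𝓚_v`, of index `#E(K_v)[p] ∈ {1, p}` over `𝓚_v` — additive places contribute
their Tamagawa witnesses and nothing else, at every level.  `hI` is NECESSARY for §2 (it fails at
good and at multiplicative places, where the door is governed by divisibility / the Tate curve —
not claimed here).

References: R. Greenberg, LNM 1716 (1999) §2 Prop. 2.1 (p. 72), p. 74, §3 Lemma 3.3 (pp. 86–87)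
[GreenbergLNM1716]; J. S. Milne, *ADT* (2006) I §2 (unramified cohomology), I Prop. 3.8
[MilneADT2006]; K. Rubin, *Euler systems* (2000) Lemma 1.3.5 / PCMI Prop. 1.4.13 [Rubin2011];
J.-P. Serre, *Galois Cohomology* I §2, I §5.1 [SerreGaloisCohomology1997].
-/

set_option autoImplicit false

noncomputable section

open scoped Classical ContRepresentation

open CategoryTheory Field ValuativeRel NumberField IsDedekindDomain Function
open Literature.NumberTheory.EllipticCurves Literature.NumberTheory.GaloisRepresentations
  Literature.NumberTheory.GaloisRepresentations.IsNonarchimedeanLocalField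
open Summit.BirchSwinnertonDyer.Rank1Residual.X11b

namespace Summit.BirchSwinnertonDyer.Rank1Residual.Additive

universe u



/-! ### §2 Elliptic curves at `v ∤ p`: dying in `H¹(H, E(K̄_v))`, `H ⊇ I_v`, forces `H¹_ur ⊔ 𝓚_v` -/

section Curve

variable {K : Type u} [Field K] [NumberField K] (W : WeierstrassCurve K) [W.IsElliptic] (p : ℕ)
  [hp : Fact p.Prime] (v : HeightOneSpectrum (𝓞 K))

/-- **From `E(K̄_v)`-coefficients to `E[p^∞]`-coefficients on `H ⊇ I_v`.** Let `v ∤ p`, `H ≤ Γ_{K_v}`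
a subgroup containing `absInertia K_v`, and `φ : Γ_{K_v} → E[p^k]` a continuous crossed homomorphism
whose image in `H¹(H, E(K̄_v))` vanishes: `φ(h) = h R − R` (`R ∈ E(K̄_v)`, `h ∈ H`).  Then there is
`Q ∈ E[p^∞](K̄)` with `φ(h) = h Q − Q` for all `h ∈ H`.  (`p^k R ∈ E(K̄_v)^H` is `p^k R₁ + T` with
`R₁ ∈ E(K̄_v)^H` and `T` of `p`-power order by FILE A; `Q = R − R₁` is `p`-power torsion, hence
geometric.) [cite: GreenbergLNM1716, §2 Prop. 2.1 (p. 72)] -/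
theorem exists_geomPrimaryTorsion_eq_smul_sub_of_principal_on (hpv : ((p : ℕ) : 𝓞 K) ∉ v.asIdeal)
    (k : ℕ) (H : Subgroup (absoluteGaloisGroup (v.adicCompletion K)))
    (hIH : absInertia (v.adicCompletion K) ≤ H)
    (φ : contOneCocycles (DiscreteGaloisModule.toTopRep
      (GaloisRep.restrictField (v.adicCompletion K) (W.torsionGaloisModule ((p ^ k : ℕ) : ℤ)))))
    {R : localPoints W (v.adicCompletion K)}
    (hR : ∀ h ∈ H, pointsMap W (v.adicCompletion K) (φ.1 h : W.geomTorsion ((p ^ k : ℕ) : ℤ)) =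
      h • R - R) :
    ∃ Q : W.geomPrimaryTorsion p, ∀ h ∈ H,
      ((φ.1 h : W.geomTorsion ((p ^ k : ℕ) : ℤ)) : W.geomPoints) =
        resGal (K := K) (v.adicCompletion K) h • (Q : W.geomPoints) - Q := by
  haveI : NeZero p := ⟨hp.out.ne_zero⟩
  -- `S = p^k • R` is fixed by `H`
  have hS : ∀ h ∈ H, h • ((p ^ k : ℕ) • R) = (p ^ k : ℕ) • R := fun h hh ↦ by
    have e : (p ^ k : ℕ) • (h • R - R) = 0 := by
      rw [← hR h hh, ← map_nsmul, ← AddSubgroupClass.coe_nsmul, Levels.pow_nsmul_geomTorsion_eq_zero,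
        ZeroMemClass.coe_zero, map_zero]
    rw [nsmul_sub, sub_eq_zero] at e
    rw [smul_comm, e]
  -- FILE A: `S = p^k • R₁ + T` with `R₁` fixed by `H` and `T` of `p`-power order
  obtain ⟨R₁, hR₁, hT⟩ :=
    exists_fixed_sub_pow_nsmul_mem_primaryComponent W p v hpv H hIH _ hS k
  -- `Q₀ = R - R₁` is `p`-power torsion
  have hQ₀ : R - R₁ ∈ AddCommGroup.primaryComponent (localPoints W (v.adicCompletion K)) p := by
    refine PrimaryCoinvariants.mem_primaryComponent_of_nsmul_mem p (k := k) ?_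
    rwa [nsmul_sub]
  obtain ⟨j, hj⟩ := (PrimaryCoinvariants.mem_primaryComponent_iff_exists_nsmul p _).mp hQ₀
  have hn : ((p ^ j : ℕ) : ℤ) ≠ 0 := by exact_mod_cast pow_ne_zero j hp.out.ne_zero
  -- transfer to a geometric torsion point
  let Q₁ : AddSubgroup.torsionBy (localPoints W (v.adicCompletion K)) ((p ^ j : ℕ) : ℤ) :=
    ⟨R - R₁, AddSubgroup.torsionBy.nsmul_iff.mpr hj⟩
  let Qg : W.geomTorsion ((p ^ j : ℕ) : ℤ) :=
    (W.torsionPointsEquiv ((p ^ j : ℕ) : ℤ) (E := v.adicCompletion K) hn).symm Q₁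
  have hQg : pointsMap W (v.adicCompletion K) (Qg : W.geomPoints) = R - R₁ :=
    W.pointsMap_torsionPointsEquiv_symm ((p ^ j : ℕ) : ℤ) hn Q₁
  refine ⟨⟨(Qg : W.geomPoints), Levels.geomTorsion_pow_le_geomPrimaryTorsion W p j Qg.2⟩, fun h hh ↦ ?_⟩
  apply pointsMapOfEmb_injective W (closureEmb (K := K) (v.adicCompletion K))
  change pointsMap W (v.adicCompletion K) _ = pointsMap W (v.adicCompletion K) _
  rw [hR h hh, map_sub, pointsMap_smul, hQg, smul_sub, hR₁ h hh]
  abel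

/-- **THE DOOR CONVERSE at `v ∤ p` (general exponent).** Let `E = W` be an elliptic curve over a
number field `K`, `p` a prime, `v ∤ p` a finite place such that every `I_v`-fixed point of
`E[p^∞](K̄)` is killed by `p^k` (`hI`; true at every additive `v ∤ p` for `p` odd, `k ≥ 1`), and
`H ≤ Γ_{K_v}` ANY subgroup containing `absInertia K_v` (e.g. `Gal(K̄_v/K_{∞,η})` for a
`ℤ_p`-extension).  If the image of `c ∈ H¹(K_v, E[p^k])` in `H¹(H, E(K̄_v))` vanishes, then
`c ∈ H¹_ur(K_v, E[p^k]) ⊔ 𝓚_v`. [cite: GreenbergLNM1716, §2 Prop. 2.1 (p. 72) and p. 74]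
[cite: MilneADT2006, Ch. I §2 and Prop. 3.8] -/
theorem mem_unramifiedSubgroup_sup_kummerLocalConditionAt_pow_of_resH1Hom_eq_zero
    (hpv : ((p : ℕ) : 𝓞 K) ∉ v.asIdeal) (k : ℕ)
    (hI : ∀ Q : W.geomPrimaryTorsion p,
      (∀ τ ∈ absInertia (v.adicCompletion K),
        GaloisRep.restrictField (v.adicCompletion K) (LocBridge.primaryGaloisModule W p) τ Q = Q) →
      p ^ k • Q = 0)
    (H : Subgroup (absoluteGaloisGroup (v.adicCompletion K)))
    (hIH : absInertia (v.adicCompletion K) ≤ H)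
    {c : galoisCohomology
      (GaloisRep.restrictField (v.adicCompletion K) (W.torsionGaloisModule ((p ^ k : ℕ) : ℤ))) 1}
    (hc : resH1Hom (Literature.NumberTheory.EllipticCurves.subgroupIncl H)
        (AddMonoidHom.id (localPoints W (v.adicCompletion K))) (fun _ _ ↦ rfl)
      (galoisCohomology.map (W.torsionPointsMapIntertwining ((p ^ k : ℕ) : ℤ) (v.adicCompletion K))
        1 c) = 0) :
    c ∈ DiscreteGaloisModule.unramifiedSubgroup
        (GaloisRep.restrictField (v.adicCompletion K) (W.torsionGaloisModule ((p ^ k : ℕ) : ℤ))) 1 ⊔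
      W.kummerLocalConditionAt ((p ^ k : ℕ) : ℤ) (v.adicCompletion K) := by
  have hn : ((p ^ k : ℕ) : ℤ) ≠ 0 := by exact_mod_cast pow_ne_zero k hp.out.ne_zero
  obtain ⟨φ, rfl⟩ := oneCocycleClass_surjective _ c
  -- unpack the vanishing in `H¹(H, E(K̄_v))`: `φ(h) = h R - R` on `H`
  rw [W.map_torsionPointsMapIntertwining_oneCocycleClass,
    LocBridge.resH1Hom_oneCocycleClass_eq_zero_iff _ _ _ Function.bijective_id] at hc
  obtain ⟨R, hR⟩ := hc
  have hR' : ∀ h ∈ H, pointsMap W (v.adicCompletion K) (φ.1 h : W.geomTorsion ((p ^ k : ℕ) : ℤ)) =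
      h • R - R := fun h hh ↦ hR ⟨h, hh⟩
  -- coefficient change (FILE A): `φ(h) = h Q - Q` on `H` with `Q ∈ E[p^∞]`
  obtain ⟨Q, hQ⟩ := exists_geomPrimaryTorsion_eq_smul_sub_of_principal_on W p v hpv k H hIH φ hR'
  -- §1 with `i = E[p^k] ↪ E[p^∞]`, whose kernel on `H¹` is `𝓚_v` at `v ∤ p`
  rw [LevelKummer.kummerLocalConditionAt_eq_ker_map_primaryInclusion W p k v hpv hn]
  refine mem_unramifiedSubgroup_sup_ker_map_of_principal_on_absInertia
    (Levels.exists_primaryInclusion_restrictField_eq_of_nsmul_eq_zero W p k (v.adicCompletion K))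
    (Levels.primaryInclusion_restrictField_injective W p k (v.adicCompletion K))
    (Levels.pow_nsmul_geomTorsion_eq_zero W p k) hI φ (b := Q) fun τ hτ ↦ ?_
  apply Subtype.ext
  rw [AddSubgroupClass.coe_sub]
  exact hQ τ (hIH hτ)

/-- **THE DOOR CONVERSE at `v ∤ p`, `p`-torsion classes** (the `k = 1` form, in the `(p : ℤ)`
currency of p10's `UnramifiedClassesLocal` / `RationalClassesToLayerZero`): if every `I_v`-fixed
point of `E[p^∞](K̄)` is killed by `p` (`hI`, the binder of row T-E3g-ADD FILE A, discharged at every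
additive `v ∤ p` for `p` odd), `H ≤ Γ_{K_v}` contains `absInertia K_v`, and the image of
`c ∈ H¹(K_v, E[p])` in `H¹(H, E(K̄_v))` vanishes, then `c ∈ H¹_ur(K_v, E[p]) ⊔ 𝓚_v`.
[cite: GreenbergLNM1716, §2 Prop. 2.1 (p. 72) and p. 74] [cite: MilneADT2006, Ch. I §2 and Prop. 3.8] -/
theorem mem_unramifiedSubgroup_sup_kummerLocalConditionAt_of_resH1Hom_eq_zero
    (hpv : ((p : ℕ) : 𝓞 K) ∉ v.asIdeal)
    (hI : ∀ Q : W.geomPrimaryTorsion p,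
      (∀ τ ∈ absInertia (v.adicCompletion K),
        GaloisRep.restrictField (v.adicCompletion K) (LocBridge.primaryGaloisModule W p) τ Q = Q) →
      p • Q = 0)
    (H : Subgroup (absoluteGaloisGroup (v.adicCompletion K)))
    (hIH : absInertia (v.adicCompletion K) ≤ H)
    {c : galoisCohomology
      (GaloisRep.restrictField (v.adicCompletion K) (W.torsionGaloisModule (p : ℤ))) 1}
    (hc : resH1Hom (Literature.NumberTheory.EllipticCurves.subgroupIncl H)
        (AddMonoidHom.id (localPoints W (v.adicCompletion K))) (fun _ _ ↦ rfl)
      (galoisCohomology.map (W.torsionPointsMapIntertwining (p : ℤ) (v.adicCompletion K)) 1 c) = 0) :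
    c ∈ DiscreteGaloisModule.unramifiedSubgroup
        (GaloisRep.restrictField (v.adicCompletion K) (W.torsionGaloisModule (p : ℤ))) 1 ⊔
      W.kummerLocalConditionAt (p : ℤ) (v.adicCompletion K) := by
  have h : ∀ {c : galoisCohomology
      (GaloisRep.restrictField (v.adicCompletion K) (W.torsionGaloisModule ((p ^ 1 : ℕ) : ℤ))) 1},
      resH1Hom (Literature.NumberTheory.EllipticCurves.subgroupIncl H)
        (AddMonoidHom.id (localPoints W (v.adicCompletion K))) (fun _ _ ↦ rfl)
        (galoisCohomology.map
          (W.torsionPointsMapIntertwining ((p ^ 1 : ℕ) : ℤ) (v.adicCompletion K)) 1 c) = 0 →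
      c ∈ DiscreteGaloisModule.unramifiedSubgroup
          (GaloisRep.restrictField (v.adicCompletion K)
            (W.torsionGaloisModule ((p ^ 1 : ℕ) : ℤ))) 1 ⊔
        W.kummerLocalConditionAt ((p ^ 1 : ℕ) : ℤ) (v.adicCompletion K) := fun hc ↦
    mem_unramifiedSubgroup_sup_kummerLocalConditionAt_pow_of_resH1Hom_eq_zero W p v hpv 1
      (fun Q hQ ↦ by rw [pow_one]; exact hI Q hQ) H hIH hc
  rw [pow_one] at h
  exact h hc

/-! ### §3 `I_v ≤ Gal(K̄_v/K_{∞,η})` and the door as an `iff` with p10's direction -/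

/-- **`absInertia K_v ≤ Gal(K̄_v/K_{∞,η})` for every `ℤ_p`-extension `κ` of `K` and `v ∤ p`**: a
continuous `ℤ_p`-valued character of `Γ_{K_v}` kills the inertia group when the residue
characteristic is not `p` (the tree's `apply_eq_one_of_mem_absInertia`; Washington Prop. 13.2).
[cite: Washington1997, Prop. 13.2] -/
theorem absInertia_le_localSubgroup_kerSubgroup (κ : ZpExtension K p)
    (hpv : ((p : ℕ) : 𝓞 K) ∉ v.asIdeal) :
    absInertia (v.adicCompletion K) ≤ localSubgroup κ.kerSubgroup (v.adicCompletion K) := by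
  intro τ hτ
  rw [mem_localSubgroup_iff, ZpExtension.mem_kerSubgroup]
  exact apply_eq_one_of_mem_absInertia (v.ringChar_residueField_adicCompletion_ne hpv)
    (κ.toContinuousMonoidHom.comp (resGal (K := K) (v.adicCompletion K))) hτ

/-- **THE DOOR AT `v ∤ p` (as an `iff`).** For a `ℤ_p`-extension `κ` of `K`, a finite place `v ∤ p`
not totally split in `K_∞` (`hdec`, used in `←` only) at which every `I_v`-fixed point of `E[p^∞]` is
killed by `p` (`hI`, used in `→` only): a class `c ∈ H¹(K_v, E[p])` dies in
`H¹(Gal(K̄_v/K_{∞,η}), E(K̄_v))` — the local condition of `Sel_{p^∞}(E/K_∞)` at `v` on `p`-torsion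
classes — IFF `c ∈ H¹_ur(K_v, E[p]) ⊔ 𝓚_v`.  `←` is p10's
`resH1Hom_localSubgroup_map_eq_zero_of_mem_unramified_sup_kummer` (T-E3g-BUD0 FILE 3b, p264947);
`→` is this file. [cite: GreenbergLNM1716, §2 Prop. 2.1 (p. 72), p. 74 and §3 Lemma 3.3 (pp. 86–87)] -/
theorem resH1Hom_localSubgroup_map_eq_zero_iff_mem_unramified_sup_kummer (κ : ZpExtension K p)
    (hpv : ((p : ℕ) : 𝓞 K) ∉ v.asIdeal)
    (hdec : ∃ σ : absoluteGaloisGroup (v.adicCompletion K),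
      κ (resGal (K := K) (v.adicCompletion K) σ) ≠ 1)
    (hI : ∀ Q : W.geomPrimaryTorsion p,
      (∀ τ ∈ absInertia (v.adicCompletion K),
        GaloisRep.restrictField (v.adicCompletion K) (LocBridge.primaryGaloisModule W p) τ Q = Q) →
      p • Q = 0)
    (c : galoisCohomology
      (GaloisRep.restrictField (v.adicCompletion K) (W.torsionGaloisModule (p : ℤ))) 1) :
    resH1Hom (Literature.NumberTheory.EllipticCurves.subgroupIncl
        (localSubgroup κ.kerSubgroup (v.adicCompletion K)))
        (AddMonoidHom.id (localPoints W (v.adicCompletion K))) (fun _ _ ↦ rfl)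
      (galoisCohomology.map (W.torsionPointsMapIntertwining (p : ℤ) (v.adicCompletion K)) 1 c) = 0 ↔
    c ∈ DiscreteGaloisModule.unramifiedSubgroup
        (GaloisRep.restrictField (v.adicCompletion K) (W.torsionGaloisModule (p : ℤ))) 1 ⊔
      W.kummerLocalConditionAt (p : ℤ) (v.adicCompletion K) :=
  ⟨fun hc ↦ mem_unramifiedSubgroup_sup_kummerLocalConditionAt_of_resH1Hom_eq_zero W p v hpv hI
      (localSubgroup κ.kerSubgroup (v.adicCompletion K))
      (absInertia_le_localSubgroup_kerSubgroup p v κ hpv) hc,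
    fun hc ↦ resH1Hom_localSubgroup_map_eq_zero_of_mem_unramified_sup_kummer W p κ v hpv hdec hc⟩

/-! ### §4 Additive places `v ∤ p`, `p` odd: the binder `hI` discharged (row T-E3g-ADD FILE B) -/

/-- **THE DOOR CONVERSE AT AN ADDITIVE PLACE `v ∤ p`, `p` odd (binder-free).** For `H ≤ Γ_{K_v}`
containing `absInertia K_v`, a class `c ∈ H¹(K_v, E[p])` dying in `H¹(H, E(K̄_v))` lies in
`H¹_ur(K_v, E[p]) ⊔ 𝓚_v` — `hI` holds by `inertia_torsion_of_hasAdditiveReductionAt`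
(Kodaira–Néron: `E(K_v^nr)[p^∞] ↪ Φ_v(k̄_v)`, of order `≤ 4`). Multiplicative places are NOT
covered (there `hI` fails: `μ_{p^∞} ⊂ E[p^∞]^{I_v}` on the Tate curve).
[cite: SilvermanAEC2009, Thm. VII.6.1] [cite: GreenbergLNM1716, §2, p. 74] -/
theorem mem_unramifiedSubgroup_sup_kummerLocalConditionAt_of_resH1Hom_eq_zero_of_hasAdditiveReductionAt
    (hpv : ((p : ℕ) : 𝓞 K) ∉ v.asIdeal) (hp2 : p ≠ 2) (hadd : W.HasAdditiveReductionAt v)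
    (H : Subgroup (absoluteGaloisGroup (v.adicCompletion K)))
    (hIH : absInertia (v.adicCompletion K) ≤ H)
    {c : galoisCohomology
      (GaloisRep.restrictField (v.adicCompletion K) (W.torsionGaloisModule (p : ℤ))) 1}
    (hc : resH1Hom (Literature.NumberTheory.EllipticCurves.subgroupIncl H)
        (AddMonoidHom.id (localPoints W (v.adicCompletion K))) (fun _ _ ↦ rfl)
      (galoisCohomology.map (W.torsionPointsMapIntertwining (p : ℤ) (v.adicCompletion K)) 1 c) = 0) :
    c ∈ DiscreteGaloisModule.unramifiedSubgroup
        (GaloisRep.restrictField (v.adicCompletion K) (W.torsionGaloisModule (p : ℤ))) 1 ⊔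
      W.kummerLocalConditionAt (p : ℤ) (v.adicCompletion K) :=
  mem_unramifiedSubgroup_sup_kummerLocalConditionAt_of_resH1Hom_eq_zero W p v hpv
    (inertia_torsion_of_hasAdditiveReductionAt W p v hpv hp2 hadd) H hIH hc

/-- **General exponent at an additive place `v ∤ p`, `p` odd, `k ≥ 1`**: a class of
`H¹(K_v, E[p^k])` dying in `H¹(H, E(K̄_v))` (`H ⊇ absInertia K_v`) lies in
`H¹_ur(K_v, E[p^k]) ⊔ 𝓚_v` (`p • Q = 0` for `I_v`-fixed `Q ∈ E[p^∞]` a fortiori gives `p^k • Q = 0`).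
[cite: SilvermanAEC2009, Thm. VII.6.1] [cite: GreenbergLNM1716, §2, p. 74] -/
theorem mem_unramifiedSubgroup_sup_kummerLocalConditionAt_pow_of_resH1Hom_eq_zero_of_hasAdditiveReductionAt
    (hpv : ((p : ℕ) : 𝓞 K) ∉ v.asIdeal) (hp2 : p ≠ 2) (hadd : W.HasAdditiveReductionAt v)
    {k : ℕ} (hk : k ≠ 0) (H : Subgroup (absoluteGaloisGroup (v.adicCompletion K)))
    (hIH : absInertia (v.adicCompletion K) ≤ H)
    {c : galoisCohomology
      (GaloisRep.restrictField (v.adicCompletion K) (W.torsionGaloisModule ((p ^ k : ℕ) : ℤ))) 1}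
    (hc : resH1Hom (Literature.NumberTheory.EllipticCurves.subgroupIncl H)
        (AddMonoidHom.id (localPoints W (v.adicCompletion K))) (fun _ _ ↦ rfl)
      (galoisCohomology.map (W.torsionPointsMapIntertwining ((p ^ k : ℕ) : ℤ) (v.adicCompletion K))
        1 c) = 0) :
    c ∈ DiscreteGaloisModule.unramifiedSubgroup
        (GaloisRep.restrictField (v.adicCompletion K) (W.torsionGaloisModule ((p ^ k : ℕ) : ℤ))) 1 ⊔
      W.kummerLocalConditionAt ((p ^ k : ℕ) : ℤ) (v.adicCompletion K) := by
  obtain ⟨j, rfl⟩ := Nat.exists_eq_succ_of_ne_zero hk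
  refine mem_unramifiedSubgroup_sup_kummerLocalConditionAt_pow_of_resH1Hom_eq_zero W p v hpv _
    (fun Q hQ ↦ ?_) H hIH hc
  rw [pow_succ, mul_nsmul', inertia_torsion_of_hasAdditiveReductionAt W p v hpv hp2 hadd Q hQ,
    smul_zero]

/-- **THE DOOR AT AN ADDITIVE PLACE `v ∤ p`, `p` odd, as an `iff`** (`hdec`: `v` not totally split
in `K_∞` — p10's binder, used in `←` only; automatic for the cyclotomic tower): on `p`-torsion
classes the local condition of `Sel_{p^∞}(E/K_∞)` at `v` IS `H¹_ur(K_v, E[p]) ⊔ 𝓚_v` (a direct sum by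
row T-E3g-ADD: `unramifiedSubgroup_inf_kummerLocalConditionAt_eq_bot_of_hasAdditiveReductionAt`, of
index `#E(K_v)[p] ∈ {1, p}` over `𝓚_v`). [cite: GreenbergLNM1716, §2, p. 74 and §3 Lemma 3.3]
[cite: SilvermanAEC2009, Thm. VII.6.1] -/
theorem resH1Hom_localSubgroup_map_eq_zero_iff_mem_unramified_sup_kummer_of_hasAdditiveReductionAt
    (κ : ZpExtension K p) (hpv : ((p : ℕ) : 𝓞 K) ∉ v.asIdeal) (hp2 : p ≠ 2)
    (hadd : W.HasAdditiveReductionAt v)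
    (hdec : ∃ σ : absoluteGaloisGroup (v.adicCompletion K),
      κ (resGal (K := K) (v.adicCompletion K) σ) ≠ 1)
    (c : galoisCohomology
      (GaloisRep.restrictField (v.adicCompletion K) (W.torsionGaloisModule (p : ℤ))) 1) :
    resH1Hom (Literature.NumberTheory.EllipticCurves.subgroupIncl
        (localSubgroup κ.kerSubgroup (v.adicCompletion K)))
        (AddMonoidHom.id (localPoints W (v.adicCompletion K))) (fun _ _ ↦ rfl)
      (galoisCohomology.map (W.torsionPointsMapIntertwining (p : ℤ) (v.adicCompletion K)) 1 c) = 0 ↔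
    c ∈ DiscreteGaloisModule.unramifiedSubgroup
        (GaloisRep.restrictField (v.adicCompletion K) (W.torsionGaloisModule (p : ℤ))) 1 ⊔
      W.kummerLocalConditionAt (p : ℤ) (v.adicCompletion K) :=
  resH1Hom_localSubgroup_map_eq_zero_iff_mem_unramified_sup_kummer W p v κ hpv hdec
    (inertia_torsion_of_hasAdditiveReductionAt W p v hpv hp2 hadd) c

end Curve

end Summit.BirchSwinnertonDyer.Rank1Residual.Additive

end
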